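import Summits.Ventures.HodgeRepro2.BallGroup

/-!
# B2.5(b), second half: `U(2,1)` is transitive on negative lines, and the conjugacy class
`X` is in bijection with them

Companion of `BallGroup.lean` (which fixes the form `H`, the group `U(2,1)`, the Hodge map
`h₁(z) = diag(1, 1, z/z̄)` and proves that the `(z/z̄)`-eigenline of `g h₁ g⁻¹` is the negative
line `g·ℂe₃`).  This file kernel-checks the remaining two steps of step B2.5(b) of
route/TIER4.md (sub-claim B2):

* **transitivity** — every vector `v` with `H(v, v) = −1` is `g·e₃` for some `g ∈ U(2,1)`
  (`exists_isU21_mulVec_single`), hence every negative line is `g·ℂe₃`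
  (`exists_isU21_smul_mulVec_single`).  B2.5(b) argues by Gram–Schmidt; here `g` is produced
  explicitly as an `H`-reflection: for `c = v₃` and `s = |c| ≥ 1`, the phase-normalised vector
  `v' = (c̄/s)·v` satisfies `H(v', e₃) = −s`, so `u = v' − e₃` has `H(u, u) = 2(s − 1) ≠ 0` when
  `v ∉ ℂe₃`, and the reflection `R_u` (an isometry of `H`, `hform_refl`) sends `e₃ ↦ v'`;
  a final `diag(1, 1, c/s) ∈ U(2,1)` removes the phase.  (If `v ∈ ℂe₃`, `g = diag(1, 1, c)`.)
* **well-definedness** — if `g, g' ∈ U(2,1)` give the same line `g·ℂe₃ = g'·ℂe₃`, then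
  `g' h₁(z) g'⁻¹ = g h₁(z) g⁻¹` (`conj_hodge_eq_of_mulVec_single_eq_smul`): the stabiliser of
  `ℂe₃` in `U(2,1)` is block diagonal (`U(2) × U(1)`) and commutes with `h₁(z)`
  (`commute_hodge_of_mulVec_single`).

Together with `BallGroup.lean` and `BallLines.lean` this is the whole of B2.5(b) except for the
identification of `X` with the coset space of Moonen 1.5 (quoted, not formalised).
-/

namespace Summit.Ventures.HodgeRepro2.BallTransitive

open Matrix BallGroup

/-! ### Transitivity of `U(2,1)` on negative lines (B2.5(b), the Gram–Schmidt step) -/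

/-- `H` is conjugate-linear in the first variable. -/
theorem hform_smul_left (c : ℂ) (v w : Fin 3 → ℂ) : hform (c • v) w = star c * hform v w := by
  simp only [hform_apply, Pi.smul_apply, smul_eq_mul, star_mul']
  ring

/-- `H` is linear in the second variable. -/
theorem hform_smul_right (c : ℂ) (v w : Fin 3 → ℂ) : hform v (c • w) = c * hform v w := by
  simp only [hform_apply, Pi.smul_apply, smul_eq_mul]
  ring

/-- `H` is additive in the first variable. -/
theorem hform_sub_left (u v w : Fin 3 → ℂ) : hform (u - v) w = hform u w - hform v w := by
  simp only [hform_apply, Pi.sub_apply, star_sub]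
  ring

/-- `H` is additive in the second variable. -/
theorem hform_sub_right (u v w : Fin 3 → ℂ) : hform u (v - w) = hform u v - hform u w := by
  simp only [hform_apply, Pi.sub_apply]
  ring

/-- Hermitian symmetry: `H(w, v) = conj H(v, w)`. -/
theorem star_hform (v w : Fin 3 → ℂ) : star (hform v w) = hform w v := by
  simp only [hform_apply, star_sub, star_add, star_mul', star_star]
  ring

/-- `H(v, v)` is real. -/
theorem star_hform_self (v : Fin 3 → ℂ) : star (hform v v) = hform v v := star_hform v v

/-- `(gᴴ J g)ᵢⱼ = H(g eᵢ, g eⱼ)`. -/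
theorem conjTranspose_mul_J_mul_apply (g : Matrix (Fin 3) (Fin 3) ℂ) (i j : Fin 3) :
    (gᴴ * BallGroup.J * g) i j = hform (g *ᵥ Pi.single i 1) (g *ᵥ Pi.single j 1) := by
  rw [Matrix.mulVec_single_one, Matrix.mulVec_single_one, hform_apply]
  simp [Matrix.mul_apply, BallGroup.J, Fin.sum_univ_three, Matrix.conjTranspose_apply, Matrix.col]
  ring

/-- On the standard basis `H(eᵢ, eⱼ) = Jᵢⱼ`. -/
theorem hform_single_single (i j : Fin 3) :
    hform (Pi.single i 1) (Pi.single j 1) = BallGroup.J i j := by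
  fin_cases i <;> fin_cases j <;> simp [hform_apply, BallGroup.J]

/-- A matrix preserving `H` on all pairs of vectors lies in `U(2,1)`. -/
theorem isU21_of_forall_hform {g : Matrix (Fin 3) (Fin 3) ℂ}
    (hg : ∀ v w, hform (g *ᵥ v) (g *ᵥ w) = hform v w) : IsU21 g := by
  unfold IsU21
  ext i j
  rw [conjTranspose_mul_J_mul_apply, hg, hform_single_single]

/-- The `H`-reflection in a vector `u` with `H(u, u) ≠ 0`:
`R_u x = x − (2 H(u, x) / H(u, u)) u`, as a matrix. -/
noncomputable def refl (u : Fin 3 → ℂ) : Matrix (Fin 3) (Fin 3) ℂ :=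
  1 - (2 / hform u u) • Matrix.vecMulVec u (star u ᵥ* BallGroup.J)

/-- `H(u, x) = (ūJ) · x`, the row-vector form used for the reflection matrix. -/
theorem hform_eq_vecMul (u x : Fin 3 → ℂ) : hform u x = (star u ᵥ* BallGroup.J) ⬝ᵥ x := by
  unfold hform
  rw [Matrix.dotProduct_mulVec]

/-- The reflection formula `R_u x = x − (2 H(u, x) / H(u, u)) u`. -/
theorem refl_mulVec (u x : Fin 3 → ℂ) :
    refl u *ᵥ x = x - (2 / hform u u * hform u x) • u := by
  unfold refl
  rw [Matrix.sub_mulVec, Matrix.one_mulVec, Matrix.smul_mulVec, Matrix.vecMulVec_mulVec,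
    op_smul_eq_smul, smul_smul, ← hform_eq_vecMul]

/-- Reflections preserve `H` (the sesquilinear identity of B2.5(b)'s Gram–Schmidt step). -/
theorem hform_refl {u : Fin 3 → ℂ} (hu : hform u u ≠ 0) (x y : Fin 3 → ℂ) :
    hform (refl u *ᵥ x) (refl u *ᵥ y) = hform x y := by
  rw [refl_mulVec, refl_mulVec, hform_sub_left, hform_sub_right, hform_sub_right, hform_smul_left,
    hform_smul_right, hform_smul_right, hform_smul_left]
  simp only [star_mul', star_div₀, star_ofNat, star_hform_self, star_hform]
  field_simp
  ring

/-- Reflections in anisotropic vectors lie in `U(2,1)`. -/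
theorem isU21_refl {u : Fin 3 → ℂ} (hu : hform u u ≠ 0) : IsU21 (refl u) :=
  isU21_of_forall_hform (hform_refl hu)

/-- The diagonal elements `diag(1, 1, ν)`, `|ν| = 1`, of `U(2,1)`. -/
theorem isU21_diag {ν : ℂ} (hν : star ν * ν = 1) : IsU21 (Matrix.diagonal ![1, 1, ν]) := by
  unfold IsU21
  ext i j
  fin_cases i <;> fin_cases j <;> simp [BallGroup.J, Matrix.mul_diagonal]
  linear_combination hν

/-- **Transitivity (B2.5(b)).** Every vector `v` with `H(v, v) = −1` is `g·e₃` for some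
`g ∈ U(2,1)`: either `v ∈ ℂe₃` (then `g = diag(1, 1, v₃)`), or `v ∉ ℂe₃` and `g` is the
`H`-reflection in `u = (c̄/|c|)·v − e₃` followed by `diag(1, 1, c/|c|)`, `c = v₃`. -/
theorem exists_isU21_mulVec_single (v : Fin 3 → ℂ) (hv : hform v v = -1) :
    ∃ g : Matrix (Fin 3) (Fin 3) ℂ, IsU21 g ∧ g *ᵥ e₃ = v := by
  -- notation: c = v₃, s = |c| ≥ 1
  have hre : ‖v 0‖ ^ 2 + ‖v 1‖ ^ 2 - ‖v 2‖ ^ 2 = -1 := by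
    have := hform_self_re v
    rw [hv, BallLines.hermForm21] at this
    simpa using this.symm
  have hs2 : ‖v 2‖ ^ 2 = 1 + (‖v 0‖ ^ 2 + ‖v 1‖ ^ 2) := by linarith
  have hs1 : 1 ≤ ‖v 2‖ ^ 2 := by nlinarith [sq_nonneg ‖v 0‖, sq_nonneg ‖v 1‖]
  have hspos : 0 < ‖v 2‖ := by
    by_contra h
    have : ‖v 2‖ = 0 := le_antisymm (not_lt.1 h) (norm_nonneg _)
    rw [this] at hs1
    norm_num at hs1
  have hc : v 2 ≠ 0 := norm_pos_iff.1 hspos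
  set s : ℝ := ‖v 2‖ with hs
  have hcc : star (v 2) * v 2 = (s : ℂ) ^ 2 := by
    rw [Complex.star_def, Complex.conj_mul']
  by_cases h1 : s = 1
  · -- `v = (0, 0, c)` with `|c| = 1`
    have h0 : ‖v 0‖ ^ 2 + ‖v 1‖ ^ 2 = 0 := by
      have := hs2
      rw [h1] at this
      norm_num at this
      linarith
    have hv0 : v 0 = 0 := by
      have : ‖v 0‖ ^ 2 = 0 := by nlinarith [sq_nonneg ‖v 0‖, sq_nonneg ‖v 1‖]
      simpa using this
    have hv1 : v 1 = 0 := by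
      have : ‖v 1‖ ^ 2 = 0 := by nlinarith [sq_nonneg ‖v 0‖, sq_nonneg ‖v 1‖]
      simpa using this
    refine ⟨Matrix.diagonal ![1, 1, v 2], isU21_diag ?_, ?_⟩
    · rw [hcc, h1]
      norm_num
    · ext i
      fin_cases i <;> simp [e₃, Matrix.mulVec_diagonal, hv0, hv1]
  · -- the reflection step
    set lam : ℂ := star (v 2) / s with hlam
    have hsC : (s : ℂ) ≠ 0 := by exact_mod_cast hspos.ne'
    have hlam_star : star lam = v 2 / s := by
      rw [hlam, star_div₀, star_star, Complex.star_def, Complex.conj_ofReal]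
    have hlam_norm : star lam * lam = 1 := by
      rw [hlam_star, hlam, div_mul_div_comm, mul_comm (v 2), hcc, sq]
      exact div_self (mul_ne_zero hsC hsC)
    set v' : Fin 3 → ℂ := lam • v with hv'
    have hve : hform v e₃ = -(star (v 2)) := by
      rw [hform_apply]
      simp [e₃]
    have hv'e : hform v' e₃ = -(s : ℂ) := by
      rw [hv', hform_smul_left, hlam_star, hve, mul_neg, div_mul_eq_mul_div, mul_comm (v 2), hcc,
        sq, mul_div_assoc, div_self hsC, mul_one]
    have hev' : hform e₃ v' = -(s : ℂ) := by
      rw [← star_hform, hv'e, star_neg, Complex.star_def, Complex.conj_ofReal]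
    have hv'v' : hform v' v' = -1 := by
      rw [hv', hform_smul_left, hform_smul_right, hv, ← mul_assoc, hlam_norm, one_mul]
    set u : Fin 3 → ℂ := v' - e₃ with hu
    have huu : hform u u = 2 * ((s : ℂ) - 1) := by
      rw [hu, hform_sub_left, hform_sub_right, hform_sub_right, hv'v', hv'e, hev', hform_single]
      ring
    have hue : hform u e₃ = -((s : ℂ) - 1) := by
      rw [hu, hform_sub_left, hv'e, hform_single]
      ring
    have hs1C : (s : ℂ) - 1 ≠ 0 := by
      intro h
      apply h1
      have : (s : ℂ) = 1 := sub_eq_zero.1 h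
      exact_mod_cast this
    have huu0 : hform u u ≠ 0 := by
      rw [huu]
      exact mul_ne_zero two_ne_zero hs1C
    have hrefl : refl u *ᵥ e₃ = v' := by
      rw [refl_mulVec, huu, hue]
      have : 2 / (2 * ((s : ℂ) - 1)) * -((s : ℂ) - 1) = -1 := by
        field_simp
      rw [this, neg_one_smul, sub_neg_eq_add, hu, add_sub_cancel]
    -- undo the phase with `diag(1, 1, 1/λ)`
    have hlam0 : lam ≠ 0 := by
      intro h
      rw [h, mul_zero] at hlam_norm
      exact zero_ne_one hlam_norm
    refine ⟨refl u * Matrix.diagonal ![1, 1, lam⁻¹], (isU21_refl huu0).mul (isU21_diag ?_), ?_⟩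
    · rw [star_inv₀]
      rw [← mul_inv, hlam_norm, inv_one]
    · rw [← Matrix.mulVec_mulVec]
      have : Matrix.diagonal ![1, 1, lam⁻¹] *ᵥ e₃ = lam⁻¹ • e₃ := by
        ext i
        fin_cases i <;> simp [e₃, Matrix.mulVec_diagonal]
      rw [this, Matrix.mulVec_smul, hrefl, hv', smul_smul, inv_mul_cancel₀ hlam0, one_smul]

/-- Every negative line is `g·ℂe₃` for some `g ∈ U(2,1)` (rescale to `H(v, v) = −1`). -/
theorem exists_isU21_smul_mulVec_single (v : Fin 3 → ℂ) (hv : BallLines.hermForm21 v < 0) :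
    ∃ g : Matrix (Fin 3) (Fin 3) ℂ, IsU21 g ∧ ∃ c : ℂ, c ≠ 0 ∧ g *ᵥ e₃ = c • v := by
  set t : ℝ := Real.sqrt (-(BallLines.hermForm21 v)) with ht
  have htpos : 0 < t := Real.sqrt_pos.2 (by linarith)
  have ht2 : t ^ 2 = -(BallLines.hermForm21 v) := Real.sq_sqrt (by linarith)
  have hform_im : (hform v v).im = 0 := by
    have := star_hform_self v
    rw [Complex.star_def, Complex.conj_eq_iff_im] at this
    exact this
  have hvv : hform v v = ((BallLines.hermForm21 v : ℝ) : ℂ) := by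
    apply Complex.ext
    · rw [hform_self_re]; simp
    · rw [hform_im]; simp
  have hw : hform ((t⁻¹ : ℂ) • v) ((t⁻¹ : ℂ) • v) = -1 := by
    rw [hform_smul_left, hform_smul_right, hvv, star_inv₀, Complex.star_def, Complex.conj_ofReal]
    have htC : (t : ℂ) ≠ 0 := by exact_mod_cast htpos.ne'
    have hneg : BallLines.hermForm21 v = -(t ^ 2) := by linarith
    rw [hneg]
    push_cast
    field_simp
  obtain ⟨g, hg, hge⟩ := exists_isU21_mulVec_single _ hw
  refine ⟨g, hg, (t : ℂ)⁻¹, ?_, hge⟩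
  exact inv_ne_zero (by exact_mod_cast htpos.ne')

/-! ### The conjugate `g·h₁(z)·g⁻¹` depends only on the line `g·ℂe₃` -/

/-- The `i`-th entry of the `j`-th column of `k`. -/
theorem mulVec_single_apply (k : Matrix (Fin 3) (Fin 3) ℂ) (i j : Fin 3) :
    (k *ᵥ Pi.single j 1) i = k i j := by
  rw [Matrix.mulVec_single_one]
  rfl

/-- The stabiliser of the line `ℂe₃` in `U(2,1)` is block diagonal (`U(2) × U(1)`): if
`k ∈ U(2,1)` and `k e₃ = c e₃`, then `k` commutes with `h₁(z)`. -/
theorem commute_hodge_of_mulVec_single {k : Matrix (Fin 3) (Fin 3) ℂ} (hk : IsU21 k) {c : ℂ}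
    (hke : k *ᵥ e₃ = c • e₃) (z : ℂ) : k * hodge z = hodge z * k := by
  -- the third column of `k` is `(0, 0, c)`
  have h02 : k 0 2 = 0 := by
    have := congrFun hke 0
    rw [e₃, mulVec_single_apply] at this
    simpa using this
  have h12 : k 1 2 = 0 := by
    have := congrFun hke 1
    rw [e₃, mulVec_single_apply] at this
    simpa using this
  have h22 : k 2 2 = c := by
    have := congrFun hke 2
    rw [e₃, mulVec_single_apply] at this
    simpa using this
  -- `c ≠ 0` since `H(k e₃, k e₃) = −1`
  have hc : c ≠ 0 := by
    intro hc0
    have h := hform_mulVec_single hk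
    rw [hke, hc0, zero_smul, hform_apply] at h
    simp at h
  -- the third row of `k` vanishes off the diagonal: `H(k eⱼ, k e₃) = H(eⱼ, e₃) = 0`
  have hrow : ∀ j : Fin 3, j ≠ 2 → k 2 j = 0 := by
    intro j hj
    have h := hform_mulVec hk (Pi.single j 1) e₃
    rw [hke, hform_smul_right] at h
    have hJ : hform (Pi.single j 1) e₃ = 0 := by
      rw [e₃, hform_single_single]
      fin_cases j
      · simp [BallGroup.J]
      · simp [BallGroup.J]
      · exact absurd rfl hj
    rw [hJ, hform_apply] at h
    simp only [mulVec_single_apply, e₃, Pi.single_eq_same, ne_eq, Fin.reduceEq, not_false_eq_true,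
      Pi.single_eq_of_ne, mul_zero, add_zero, mul_one, zero_sub, mul_neg, neg_eq_zero,
      mul_eq_zero, star_eq_zero] at h
    rcases h with h | h
    · exact absurd h hc
    · exact h
  have h20 : k 2 0 = 0 := hrow 0 (by decide)
  have h21 : k 2 1 = 0 := hrow 1 (by decide)
  ext i j
  fin_cases i <;> fin_cases j <;>
    simp [hodge, Matrix.mul_diagonal, Matrix.diagonal_mul, h02, h12, h20, h21, mul_comm]

/-- **Well-definedness (B2.5(b)).** If `g, g' ∈ U(2,1)` span the same line `g·ℂe₃ = g'·ℂe₃`,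
then `g' h₁(z) g'⁻¹ = g h₁(z) g⁻¹`: the point of `X` attached to a negative line is
well defined, so `X ≅ {negative lines} ≅ 𝔹²` is a bijection. -/
theorem conj_hodge_eq_of_mulVec_single_eq_smul {g g' : Matrix (Fin 3) (Fin 3) ℂ} (hg : IsU21 g)
    (hg' : IsU21 g') {c : ℂ} (h : g' *ᵥ e₃ = c • (g *ᵥ e₃)) (z : ℂ) :
    g' * hodge z * g'⁻¹ = g * hodge z * g⁻¹ := by
  have hdet := isUnit_det_of_isU21 hg
  have hdet' := isUnit_det_of_isU21 hg'
  set k : Matrix (Fin 3) (Fin 3) ℂ := g⁻¹ * g' with hk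
  have hkU : IsU21 k := hg.inv.mul hg'
  have hke : k *ᵥ e₃ = c • e₃ := by
    rw [hk, ← Matrix.mulVec_mulVec, h, Matrix.mulVec_smul, inv_mulVec_mulVec hdet]
  have hcomm := commute_hodge_of_mulVec_single hkU hke z
  have hkdet := isUnit_det_of_isU21 hkU
  have hg'k : g' = g * k := by
    rw [hk, ← Matrix.mul_assoc, Matrix.mul_nonsing_inv _ hdet, Matrix.one_mul]
  rw [hg'k, Matrix.mul_inv_rev]
  calc g * k * hodge z * (k⁻¹ * g⁻¹) = g * (k * hodge z * k⁻¹) * g⁻¹ := by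
        simp only [Matrix.mul_assoc]
    _ = g * hodge z * g⁻¹ := by
        rw [hcomm, Matrix.mul_assoc (hodge z), Matrix.mul_nonsing_inv _ hkdet, Matrix.mul_one]

end Summit.Ventures.HodgeRepro2.BallTransitive
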